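import Literature.MathematicalPhysics.QuantumFieldTheory.Balaban1983to89.T4ShellMeasureAnalytic
import Literature.MathematicalPhysics.QuantumFieldTheory.Balaban1983to89.B14FlowStep

/-!
# T4ShellMeasureSMPlacement — node U5b/U5.E, cell input NE7c = `T4IndicatorShell.ShellWeightBound`, member (γ″) of
the shell-measure route: the PLACEMENT of the separation-of-scales binder (SM) against the printed threshold profile
`ε(g) = g·A₀(log g⁻²)^{p₀}`, as a FORK on the depth of the live window

(cell `pub-balaban`, T4-DAG v23 §6 row NE7c, fan-out seat `b2b-balaban-t4-ne7c-p1` gen 10, design row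
T4-U5b.E2-NE7c-PROVE-P1l*; imports `T4ShellMeasureAnalytic` (hence `Setup`'s `p0Profile` / `epsK` / `Flow` and
`T4ShellMeasureAnalytic.cauchyCoef`) and `B14FlowStep` (hence `B14.IsRj` = (2.5) and the [folklore] `log g⁻²` lemmas
`B14FlowStep.log_inv_sq_nonneg` / `log_inv_sq_mono`, consumed BY NAME); companion record `t4/T4-EST-NE7c-P1.md`
§5 (viii)/(xiv), GAPS G-ne7cp1-9, G-ne7cp1-11a, G-ne7cp1-14; PURE REAL ANALYSIS, [folklore], 0 sorry: one limit
`x·(log x⁻²)ⁿ → 0` and monotone arithmetic; every located input a binder.)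

HONEST FRAMING (T4-DAG PAGE 1).  Rung (B)+1 scoping of the T⁴-continuum cell: existence and uniqueness of the `ε → 0`
limit of unit-scale averaged expectations on a FIXED finite torus — NOT infinite volume, NOT a mass gap, NOT Clay, and
NOT a proof of NE7c.  Nothing of the run-A/run-B comparison is printed in [Balaban 1983–89]; nothing printed is
asserted here and no constant of Bałaban's is chosen.  Every conditional of the cell (BetaPertH, (B), (B^μ)) stays where
it is — upstream of the term families, untouched.  The READINGS named below (reach, majorant, threshold units) are the
record's located readings G-ne7cp1-9, G-ne7cp1-11a, G-ne7cp1-14, NOT printed and NOT kernel: they enter as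
HYPOTHESES of §4, never as facts.

WHY THIS LEAF.  Member (γ″) (`T4ShellMeasureAnalytic.fibreAlternative_of_analytic_family`, at bond level
`T4ShellMeasurePlaquette.fibreAlternative_of_bondAnalytic_family_four`) carries ONE numerical binder relating located
constants, the separation of scales
  (SM)  `(cauchyCoef H R x₀ + cauchyCoef H R x₀) · x₀² ≤ s · θ · (1 − ρ)`,  `cauchyCoef H R x₀ = 9H/(R − x₀)²`,
at every live level `j` of a run (GAPS G-ne7cp1-9: NOT PRINTED; ‹placement = the instantiator's call›).  Under the
record's readings — majorant `H ≤ h·ζ` and threshold `θ = ε_j·ζ` carrying the SAME unit factor `ζ` (G-ne7cp1-14: the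
cancellation of `η²`), reach `x₀ ≤ C_j·ε_j` with `x₀ ≤ R/2` (G-ne7cp1-11a: axial-gauge size of the good class, `C_j`
growing with the linear size of the level-`j` lattice) — (SM) at level `j` is EQUIVALENT IN KIND to the placement
inequality
  (PL_j)  `C_j² · ε(g_j) ≤ κ · s · (1 − ρ_j)`,  `ε(x) = x · p0Profile A₀ p₀ x = A₀ · x · (log x⁻²)^{p₀}`, `κ = R²/(72h)`
(§4, both directions: `binder_of_placement` under upper readings, `placement_of_binder` under lower readings with
`κ′ = R²/(18h′)`).  Whether (PL_j) is a clause of the printed KIND ‹for g sufficiently small› — the standing hypothesis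
`Flow.InInterval` of every d = 4 theorem of the series — or a relation between FIXED numbers is decided by ONE datum: how
the reach coefficient `C_j²` compares with a power of `log g⁻²` over the live window `K − N₁ ≤ j ≤ K` (its depth `N₁` is
the located input (W1), G-ne7cp1-4, `T4ShellMeasureLevels.LiveWindow.recent` — not imported, other branch).  This leaf
puts that decision in kernel as a FORK, so that the seat instantiating (GOOD′)/(TS) and (W1) reads off which branch it
is on instead of re-deriving asymptotics.

WHAT THIS LEAF DOES.
* §1 the threshold profile's asymptotics [folklore]: `log (x²)⁻¹ = 2 log x⁻¹`; `x · (log (x²)⁻¹)ⁿ → 0` as `x → 0⁺`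
  (`tendsto_mul_logInvSq_pow`, from Mathlib's `Real.tendsto_pow_log_div_mul_add_atTop` along `x ↦ x⁻¹`); the
  extracted threshold `exists_threshold_logInvSq_pow`: `∀ c > 0, ∃ g₀ ∈ (0, 1/2], ∀ x ∈ (0, g₀], M·x·(log (x²)⁻¹)ⁿ ≤ c`;
  signs and monotonicity of `log (x²)⁻¹` on `(0, 1]` (from `B14FlowStep`, by name); `mul_p0Profile_eq`
  (`x · p0Profile A₀ p₀ x = A₀ · (x · (log (x²)⁻¹)^{p₀})`) and `epsK_eq` (`epsK A₀ p₀ F k = F.g k · p0Profile A₀ p₀ (F.g k)`,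
  `rfl`).
* §2 `SMPlacement W C ρ g A₀ κ s p₀ : Prop` := `∀ j ∈ W, C j ^ 2 * (g j * p0Profile A₀ p₀ (g j)) ≤ κ * (s * (1 − ρ j))` —
  the placement form (PL) of (SM) on a window `W ⊆ ℕ` of levels with couplings `g j`, reach coefficients `C j`, widths
  `ρ j`; one line over the B14 constants socket (`p0Profile`), nothing minted.
* §3 THE FORK (all [folklore] arithmetic on top of §1):
  (A) `smPlacement_of_polylogEnvelope`: a reach envelope POLYLOGARITHMIC in the level's own coupling,
      `C j² ≤ E₀ · (log (g_j²)⁻¹)^q`, and couplings `0 < g j ≤ g₀` with `g₀` the §1 threshold for `M = E₀A₀`,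
      `n = q + p₀`, `c = κs/2` (and `ρ j ≤ 1/2`) ⇒ `SMPlacement`; `exists_threshold_smPlacement` packages the `∃ g₀`, which
      depends on `(E₀, A₀, q, p₀, κs)` ONLY — not on `K`, `W` or the run; `smPlacement_of_inInterval` is the same over a
      `Flow` under the STANDING HYPOTHESIS `Flow.InInterval F γ K` (`0 < g_k ≤ γ`, `k ≤ K`) with `γ ≤ g₀`, concluding
      `C j² · epsK A₀ p₀ F j ≤ κ s (1 − ρ j)` for all `j ≤ K`: on this branch (SM) IS a clause of the printed kind;
      `smPlacement_of_constEnvelope` (`q = 0`): a reach that does not grow with the age is always on this branch.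
  (B) `polylogEnvelope_of_floorDepth`: an AGE-GEOMETRIC envelope `C j² ≤ E₀ · Γ^{K − j}` (`1 ≤ Γ`) on a window of
      depth `N₁` (`j ≤ K ≤ j + N₁`) whose depth is of FLOOR TYPE, `Γ^{N₁} ≤ M₁ · (log (γ²)⁻¹)^ν` for an upper bound `γ ≤ 1`
      of the window's couplings, IS a polylog envelope (exponent `ν`, constant `E₀M₁`) ⇒ branch (A)
      (`smPlacement_of_floorDepth`); `pow_le_of_le_loglog` is the bridge from the log-log form of a floor-type depth,
      `N₁ ≤ N₀ + ν · log y / log Γ` ⇒ `Γ^{N₁} ≤ Γ^{N₀} · y^ν` (`1 < Γ`, `1 ≤ y`).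
  (C) `floor_of_capDepth` / `not_smPlacement_of_capDepth` / `not_binder_of_capDepth` / `not_smPlacement_of_isRj`: a
      depth of CAP TYPE, `(log (γ²)⁻¹)^r ≤ N₁` with `1 ≤ r` (= the bound conjunct of the tree's `B14.IsRj L r γ N₁`,
      B14 (2.5), consumed by name in `capDepth_of_isRj`), an envelope bounded BELOW geometrically at the oldest live
      level, `c · Γ^{N₁} ≤ C_{j₀}²` with `e ≤ Γ`, and a window coupling comparable to `γ` (`lam · γ ≤ g_{j₀} ≤ γ`,
      `1 ≤ log (γ²)⁻¹`) force `c · lam · A₀ / γ ≤ C_{j₀}² · ε(g_{j₀})` — so for EVERY `γ` below the explicit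
      `c·lam·A₀/(κs)` the placement, and (under the lower readings) the binder (SM) itself, FAILS at level `j₀`: on
      this branch (SM) is false throughout the small-coupling regime, the opposite of a ‹g sufficiently small› clause.
* §4 the two-way dictionary between (SM) and (PL) under the readings, as hypotheses: `binder_of_placement`,
  `hSM_of_smPlacement` (window form, conclusion syntactically the `hSM` binder of
  `fibreAlternative_of_analytic_family` / `_bondAnalytic_family_four` with `θ := ε_j·ζ_j`), `placement_of_binder`.
* §5 non-vacuity (kernel-checked, honest scope): the cap-type hypotheses of (C) are jointly satisfiable on explicit
  numbers (`γ = 1/2`, `N₁ = 2`, `Γ = 3`, `r = 1`) and the negation fires; the floor-type composite fires on a one-level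
  window.

PRINTED LOCI READ FOR THIS LEAF (renders read as page images by this seat, gen 10; quoted as LOCI of the two KINDS of
depth and of the profile — none is cited as authority for (SM), which is not printed):
* [Balaban1988Convergent] = B14 (CMP 119:243–285; journal page = PDF + 242) p.255 [PDF 13]: (2.4) «ε_j = g_jA₀(log g_j⁻²)^{p₀}
  = g_jp₀(g_j)» (= tree `p0Profile`/`epsK`, `Setup` §10); (2.5) «R_j is the smallest number of the form Lʳ such, that
  R_j ≥ (log g_j⁻²)ʳ.» (= tree `B14.IsRj`); (2.6) «g_m ≤ (1 + β₀)g_n, (2.6) where n > m, and β₀ > 0 can be chosen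
  arbitrarily small, if g is sufficiently small.» (the comparability KIND of the window couplings, hypotheses `hg`/`hgj`).
* [Balaban1989LargeFieldI] = B15 (CMP 122:175–202; journal page = PDF + 174) p.198 [PDF 24]: «The last inequality holds
  under two restrictions on N. At first, we assume that N ≤ O(1)(log g_k⁻²)^ν ≤ O(1)(1 + β₀)(log g_h⁻²)^ν with a positive
  integer ν satisfying (1/2)ν ≤ p₀ − p₁ − 1. The second is that N has to be sufficiently large, so that the constant in
  the second term above can be bounded by (1/2)α. These two conditions can be satisfied by N to the positive power of
  log g_k⁻².» (CAP kind, and print's own choice of N as a positive power of `log g_k⁻²`).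
* [Balaban1989LargeFieldII] = B16 (CMP 122:355–392; journal page = PDF + 354) p.361 [PDF 7]: «and dividing the number on
  the right-hand side by g_k² we get still a small number, if g_k is small enough. We have assumed here that N ≤ R_k.»;
  p.363 [PDF 9]: «The number multiplying g_k² is small if L⁻ᴺ is small enough, for example if L⁻ᴺ ≤ (log g_k⁻²)⁻ᵛ for
  sufficiently large ν, or N ≥ (ν/log L) log log g_k⁻². For the smallness of the above bound we need ν ≥ 2p₀ + dr₀.»
  (FLOOR kind); p.384 [PDF 30]: «where the number K is the smallest positive integer having the property that the domain
  Sᴷ(Z), considered as a domain in the lattice of the scale L^{−(j+K)}, satisfies the conditions (i), (ii), with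
  N = R_j.» (print PLACES N at the cap; this `K` is B16's local letter, not the cutoff).
* The standing hypothesis `0 < g_k ≤ γ` is the tree's `Flow.InInterval` ([Balaban1987RG1] Thm 1 p.256, quoted there).

LOCATED, NOT PRINTED, NOT DISCHARGED HERE (binders; record §3–§4): (SM) itself (G-ne7cp1-9); the readings `H ≤ h·ζ`,
`θ = ε_j·ζ` (G-ne7cp1-14, after the plaquette importer: `H = (5/2)B₅ε̄₁η²`-kind, `R = log(1 + C₁ε̄₁)`-kind — the VALUES
are not printed) and `x₀ ≍ C_j·ε_j` (G-ne7cp1-11a); WHICH envelope the reach coefficient has (polylog / age-geometric)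
and WHICH depth the live window has (floor / cap) — the four are hypotheses of §3, the leaf decides only the
implication table; (W1) (G-ne7cp1-4); (AN-bound) residual, (DC-fwd), (SS′), (GOOD′)/(TS), (F∞)-rate: UNCHANGED.
CONSEQUENCE RECORDED (GAPS G-ne7cp1-16): with the window depth at print's cap (`N = R_j`, B16 p.384; «N to the positive
power of log g_k⁻²», B15 p.198) AND the age-geometric reach of a GLOBAL dilation of the level-`j` lattice (G-ne7cp1-11a;
dilating a territory alone is dead end D11), member (γ″) cannot place (SM) in the small-coupling regime (§3 (C)); it
needs the depth near print's floor (B16 p.363) or an age-uniform reach.  NOT summit progress.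

ABSOLUTE RULE.  No internally-minted statement is a cited fact; every hypothesis is a binder; nothing of
[Balaban 1983–89] is instantiated or quoted as authority for a disputed step; all docstrings [folklore]; 0 sorry.
-/

open Filter Topology Set

namespace Literature.MathematicalPhysics.QuantumFieldTheory.Balaban1983to89.T4ShellMeasureSMPlacement

open T4ShellMeasureAnalytic (cauchyCoef cauchyCoef_nonneg)
open B14FlowStep (log_inv_sq_nonneg log_inv_sq_mono)

/-! ## §1 The threshold profile `ε(x) = A₀·x·(log x⁻²)^{p₀}`: asymptotics, signs, the extracted threshold -/

section Profile

/-- `log (x²)⁻¹ = 2·log x⁻¹` (no sign hypothesis: Mathlib's `Real.log_pow` is unconditional). [folklore] -/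
theorem log_inv_sq_two_mul (x : ℝ) : Real.log (x ^ 2)⁻¹ = 2 * Real.log x⁻¹ := by
  rw [← inv_pow, Real.log_pow]; push_cast; ring

/-- `x · (log (x²)⁻¹)ⁿ → 0` as `x → 0⁺`: the small-field threshold profile (2.4) tends to `0` faster than any fixed
power of `log g⁻²` grows — Mathlib's `(log y)ⁿ / y → 0` (`Real.tendsto_pow_log_div_mul_add_atTop`) along
`y = x⁻¹ → ∞`. [folklore] -/
theorem tendsto_mul_logInvSq_pow (n : ℕ) :
    Tendsto (fun x : ℝ => x * (Real.log (x ^ 2)⁻¹) ^ n) (𝓝[>] 0) (𝓝 0) := by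
  have h := ((Real.tendsto_pow_log_div_mul_add_atTop 1 0 n one_ne_zero).comp
    tendsto_inv_nhdsGT_zero).const_mul ((2 : ℝ) ^ n)
  rw [mul_zero] at h
  refine h.congr' (Eventually.of_forall fun x => ?_)
  simp only [Function.comp_apply, one_mul, add_zero, div_inv_eq_mul, log_inv_sq_two_mul, mul_pow]
  ring

/-- THE EXTRACTED THRESHOLD: for every `c > 0` there is `g₀ ∈ (0, 1/2]` with `M · x · (log (x²)⁻¹)ⁿ ≤ c` for all
`x ∈ (0, g₀]` — the ‹for g sufficiently small› clause of branch (A), with `g₀` depending on `(M, n, c)` only. [folklore] -/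
theorem exists_threshold_logInvSq_pow (M c : ℝ) (hc : 0 < c) (n : ℕ) :
    ∃ g₀ : ℝ, 0 < g₀ ∧ g₀ ≤ 1 / 2 ∧ ∀ x, 0 < x → x ≤ g₀ → M * (x * (Real.log (x ^ 2)⁻¹) ^ n) ≤ c := by
  have h := ((tendsto_mul_logInvSq_pow n).const_mul M).eventually_lt_const (by rwa [mul_zero] : M * 0 < c)
  obtain ⟨u, hu, hsub⟩ := mem_nhdsGT_iff_exists_Ioc_subset.1 h
  refine ⟨min u (1 / 2), lt_min (Set.mem_Ioi.1 hu) (by norm_num), min_le_right _ _, fun x hx hxle => ?_⟩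
  have hmem := hsub ⟨hx, hxle.trans (min_le_left _ _)⟩
  simp only [Set.mem_setOf_eq] at hmem
  exact hmem.le

/-- `1 ≤ log (x²)⁻¹` propagates down a window: if it holds at an upper bound `y` of the coupling it holds at the
coupling. [folklore] -/
theorem one_le_log_inv_sq_of_le {x y : ℝ} (hx : 0 < x) (hxy : x ≤ y) (hy : 1 ≤ Real.log (y ^ 2)⁻¹) :
    1 ≤ Real.log (x ^ 2)⁻¹ :=
  hy.trans (log_inv_sq_mono hx hxy)

/-- `x · p0Profile A₀ p₀ x = A₀ · (x · (log (x²)⁻¹)^{p₀})` — the profile (2.4) in the shape §1 controls. [folklore] -/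
theorem mul_p0Profile_eq (A₀ : ℝ) (p₀ : ℕ) (x : ℝ) :
    x * p0Profile A₀ p₀ x = A₀ * (x * (Real.log (x ^ 2)⁻¹) ^ p₀) := by
  unfold p0Profile; ring

/-- `epsK A₀ p₀ F k = F.g k · p0Profile A₀ p₀ (F.g k)` (tree `Setup` §10, `rfl`): the flow-indexed threshold is the
profile at the flow's coupling, so every statement below over couplings `g : ℕ → ℝ` applies to `g := F.g`. [folklore] -/
theorem epsK_eq (A₀ : ℝ) (p₀ : ℕ) (F : Flow) (k : ℕ) :
    epsK A₀ p₀ F k = F.g k * p0Profile A₀ p₀ (F.g k) := rfl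

/-- `0 ≤ p0Profile A₀ p₀ x` for `0 ≤ A₀`, `x ∈ (0, 1]`. [folklore] -/
theorem p0Profile_nonneg_of_le_one {A₀ x : ℝ} (hA : 0 ≤ A₀) (hx : 0 < x) (hx1 : x ≤ 1) (p₀ : ℕ) :
    0 ≤ p0Profile A₀ p₀ x :=
  mul_nonneg hA (pow_nonneg (log_inv_sq_nonneg hx hx1) _)

/-- `0 ≤ x · p0Profile A₀ p₀ x` for `0 ≤ A₀`, `x ∈ (0, 1]`. [folklore] -/
theorem mul_p0Profile_nonneg {A₀ x : ℝ} (hA : 0 ≤ A₀) (hx : 0 < x) (hx1 : x ≤ 1) (p₀ : ℕ) :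
    0 ≤ x * p0Profile A₀ p₀ x :=
  mul_nonneg hx.le (p0Profile_nonneg_of_le_one hA hx hx1 p₀)

/-- Lower bound of the profile deep in the small-coupling regime: `1 ≤ log (x²)⁻¹` (i.e. `x ≤ e^{−1/2}`) gives
`A₀ · x ≤ x · p0Profile A₀ p₀ x`. [folklore] -/
theorem mul_le_mul_p0Profile {A₀ x : ℝ} (hA : 0 ≤ A₀) (hx : 0 ≤ x) (hlog : 1 ≤ Real.log (x ^ 2)⁻¹) (p₀ : ℕ) :
    A₀ * x ≤ x * p0Profile A₀ p₀ x := by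
  rw [mul_p0Profile_eq]
  have h1 : (1 : ℝ) ≤ (Real.log (x ^ 2)⁻¹) ^ p₀ := one_le_pow₀ hlog
  calc A₀ * x = A₀ * (x * 1) := by ring
    _ ≤ A₀ * (x * (Real.log (x ^ 2)⁻¹) ^ p₀) :=
        mul_le_mul_of_nonneg_left (mul_le_mul_of_nonneg_left h1 hx) hA

end Profile

/-! ## §2 The placement form (PL) of (SM) on a window of levels -/

section Placement

/-- **(PL) — THE PLACEMENT FORM OF (SM).**  On a window `W ⊆ ℕ` of levels with couplings `g j`, reach coefficients
`C j` and relative shell widths `ρ j`:  `C j² · (g j · p0Profile A₀ p₀ (g j)) ≤ κ · s · (1 − ρ j)` for every `j ∈ W`.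
Under the record's readings (§4) this is the separation-of-scales binder (SM) of member (γ″) at every level of the
window, with `κ = R²/(72h)` (sufficiency) / `κ′ = R²/(18h′)` (necessity).  A `Prop`, i.e. a hypothesis shape —
NOT PRINTED (GAPS G-ne7cp1-9), not asserted. [folklore] -/
def SMPlacement (W : Set ℕ) (C ρ g : ℕ → ℝ) (A₀ κ s : ℝ) (p₀ : ℕ) : Prop :=
  ∀ j ∈ W, C j ^ 2 * (g j * p0Profile A₀ p₀ (g j)) ≤ κ * (s * (1 - ρ j))

/-- (PL) restricts to sub-windows. [folklore] -/
theorem SMPlacement.mono {W W' : Set ℕ} {C ρ g : ℕ → ℝ} {A₀ κ s : ℝ} {p₀ : ℕ}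
    (h : SMPlacement W C ρ g A₀ κ s p₀) (hW : W' ⊆ W) : SMPlacement W' C ρ g A₀ κ s p₀ :=
  fun j hj => h j (hW hj)

end Placement

/-! ## §3 The fork: polylog envelope / floor-type depth ⇒ (PL) for small couplings; cap-type depth ⇒ (PL) fails -/

section Fork

/-- **BRANCH (A): POLYLOG ENVELOPE ⇒ (PL) IS A SMALL-COUPLING CLAUSE.**  If on the window the reach coefficient is
polylogarithmic in the level's own coupling, `C j² ≤ E₀ · (log (g_j²)⁻¹)^q`, the couplings lie in `(0, g₀]` with
`g₀ ≤ 1` a threshold at which `E₀A₀ · x · (log (x²)⁻¹)^{q + p₀} ≤ κs/2` on `(0, g₀]` (§1 `exists_threshold_logInvSq_pow`), and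
`ρ j ≤ 1/2`, `0 ≤ κs`, then (PL) holds on the window.  `g₀` depends on `(E₀, A₀, q, p₀, κs)` only. [folklore] -/
theorem smPlacement_of_polylogEnvelope {W : Set ℕ} {C ρ g : ℕ → ℝ} {A₀ E₀ κ s g₀ : ℝ} {p₀ q : ℕ}
    (hA₀ : 0 ≤ A₀) (hg₀ : g₀ ≤ 1)
    (hthr : ∀ x, 0 < x → x ≤ g₀ → E₀ * A₀ * (x * (Real.log (x ^ 2)⁻¹) ^ (q + p₀)) ≤ κ * s / 2)
    (hg : ∀ j ∈ W, 0 < g j ∧ g j ≤ g₀)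
    (henv : ∀ j ∈ W, C j ^ 2 ≤ E₀ * (Real.log (g j ^ 2)⁻¹) ^ q)
    (hρ : ∀ j ∈ W, ρ j ≤ 1 / 2) (hκs : 0 ≤ κ * s) :
    SMPlacement W C ρ g A₀ κ s p₀ := by
  intro j hj
  obtain ⟨hg0, hgle⟩ := hg j hj
  have hε0 : 0 ≤ g j * p0Profile A₀ p₀ (g j) := mul_p0Profile_nonneg hA₀ hg0 (hgle.trans hg₀) p₀
  have hhalf : 0 ≤ κ * s * (1 / 2 - ρ j) := mul_nonneg hκs (sub_nonneg.2 (hρ j hj))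
  calc C j ^ 2 * (g j * p0Profile A₀ p₀ (g j))
      ≤ E₀ * (Real.log (g j ^ 2)⁻¹) ^ q * (g j * p0Profile A₀ p₀ (g j)) :=
        mul_le_mul_of_nonneg_right (henv j hj) hε0
    _ = E₀ * A₀ * (g j * (Real.log (g j ^ 2)⁻¹) ^ (q + p₀)) := by rw [mul_p0Profile_eq, pow_add]; ring
    _ ≤ κ * s / 2 := hthr (g j) hg0 hgle
    _ ≤ κ * (s * (1 - ρ j)) := by nlinarith [hhalf]

/-- **BRANCH (A), PACKAGED.**  For `0 ≤ A₀`, `0 < κs` there is ONE threshold `g₀ > 0` — a function of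
`(E₀, A₀, q, p₀, κs)`, not of the cutoff, the window or the run — such that (PL) holds on EVERY window whose couplings
lie in `(0, g₀]` with a polylog envelope of exponent `q` and widths `≤ 1/2`: the ‹for g sufficiently small› KIND of
clause, K-uniform by construction. [folklore] -/
theorem exists_threshold_smPlacement {A₀ E₀ κ s : ℝ} (hA₀ : 0 ≤ A₀) (hκs : 0 < κ * s) (p₀ q : ℕ) :
    ∃ g₀ : ℝ, 0 < g₀ ∧ ∀ (W : Set ℕ) (C ρ g : ℕ → ℝ),
      (∀ j ∈ W, 0 < g j ∧ g j ≤ g₀) → (∀ j ∈ W, C j ^ 2 ≤ E₀ * (Real.log (g j ^ 2)⁻¹) ^ q) →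
      (∀ j ∈ W, ρ j ≤ 1 / 2) → SMPlacement W C ρ g A₀ κ s p₀ := by
  obtain ⟨g₀, hg₀, hg₀1, hthr⟩ := exists_threshold_logInvSq_pow (E₀ * A₀) (κ * s / 2) (by linarith) (q + p₀)
  exact ⟨g₀, hg₀, fun W C ρ g hg henv hρ =>
    smPlacement_of_polylogEnvelope hA₀ (hg₀1.trans (by norm_num)) hthr hg henv hρ hκs.le⟩

/-- **BRANCH (A) OVER A FLOW, UNDER THE STANDING HYPOTHESIS.**  With `Flow.InInterval F γ K` (`0 < g_k ≤ γ` for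
`k ≤ K` — the standing hypothesis of every d = 4 theorem of the series, tree `Setup`) and `γ ≤ g₀`, a polylog envelope on
the levels `j ≤ K` gives `C j² · epsK A₀ p₀ F j ≤ κ s (1 − ρ j)` for all `j ≤ K`: on this branch (SM) is DISCHARGED IN KIND
by the standing hypothesis with `γ` small — modulo the un-displayed constants, which stay binders. [folklore] -/
theorem smPlacement_of_inInterval {F : Flow} {γ g₀ A₀ E₀ κ s : ℝ} {K p₀ q : ℕ} {C ρ : ℕ → ℝ}
    (hA₀ : 0 ≤ A₀) (hg₀ : g₀ ≤ 1)
    (hthr : ∀ x, 0 < x → x ≤ g₀ → E₀ * A₀ * (x * (Real.log (x ^ 2)⁻¹) ^ (q + p₀)) ≤ κ * s / 2)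
    (hF : F.InInterval γ K) (hγ : γ ≤ g₀)
    (henv : ∀ j ≤ K, C j ^ 2 ≤ E₀ * (Real.log (F.g j ^ 2)⁻¹) ^ q)
    (hρ : ∀ j ≤ K, ρ j ≤ 1 / 2) (hκs : 0 ≤ κ * s) :
    ∀ j ≤ K, C j ^ 2 * epsK A₀ p₀ F j ≤ κ * (s * (1 - ρ j)) := by
  have h : SMPlacement {j | j ≤ K} C ρ F.g A₀ κ s p₀ :=
    smPlacement_of_polylogEnvelope hA₀ hg₀ hthr
      (fun j hj => ⟨(hF j hj).1, (hF j hj).2.trans hγ⟩) (fun j hj => henv j hj) (fun j hj => hρ j hj) hκs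
  intro j hj
  exact h j hj

/-- **BRANCH (A), CONSTANT ENVELOPE.**  A reach coefficient that does not grow with the age (`C j² ≤ E₀` on the
window) is the case `q = 0`: (PL) holds as soon as the couplings are below the §1 threshold for `n = p₀`.  So the ONLY
obstruction to placing (SM) as a small-coupling clause is the growth of the reach with the age. [folklore] -/
theorem smPlacement_of_constEnvelope {W : Set ℕ} {C ρ g : ℕ → ℝ} {A₀ E₀ κ s g₀ : ℝ} {p₀ : ℕ}
    (hA₀ : 0 ≤ A₀) (hg₀ : g₀ ≤ 1)
    (hthr : ∀ x, 0 < x → x ≤ g₀ → E₀ * A₀ * (x * (Real.log (x ^ 2)⁻¹) ^ p₀) ≤ κ * s / 2)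
    (hg : ∀ j ∈ W, 0 < g j ∧ g j ≤ g₀) (henv : ∀ j ∈ W, C j ^ 2 ≤ E₀)
    (hρ : ∀ j ∈ W, ρ j ≤ 1 / 2) (hκs : 0 ≤ κ * s) :
    SMPlacement W C ρ g A₀ κ s p₀ :=
  smPlacement_of_polylogEnvelope (q := 0) hA₀ hg₀ (by simpa using hthr) hg (fun j hj => by simpa using henv j hj)
    hρ hκs

/-- **BRANCH (B): AGE-GEOMETRIC ENVELOPE ON A FLOOR-TYPE WINDOW IS A POLYLOG ENVELOPE.**  On a window of depth `N₁`
below `K` (`j ≤ K ≤ j + N₁`, the shape of `T4ShellMeasureLevels.LiveWindow`), a reach coefficient geometric in the AGE,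
`C j² ≤ E₀ · Γ^{K − j}` (`1 ≤ Γ`, `0 ≤ E₀`), with a depth of FLOOR TYPE, `Γ^{N₁} ≤ M₁ · (log (γ²)⁻¹)^ν` (`0 ≤ M₁`) for an
upper bound `γ ≤ 1` of the window's couplings, satisfies `C j² ≤ E₀M₁ · (log (g_j²)⁻¹)^ν`. [folklore] -/
theorem polylogEnvelope_of_floorDepth {W : Set ℕ} {C g : ℕ → ℝ} {E₀ M₁ Γ γ : ℝ} {K N₁ ν : ℕ}
    (hΓ : 1 ≤ Γ) (hE₀ : 0 ≤ E₀) (hM₁ : 0 ≤ M₁) (hγ1 : γ ≤ 1)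
    (hwin : ∀ j ∈ W, j ≤ K ∧ K ≤ j + N₁)
    (henv : ∀ j ∈ W, C j ^ 2 ≤ E₀ * Γ ^ (K - j))
    (hdepth : Γ ^ N₁ ≤ M₁ * (Real.log (γ ^ 2)⁻¹) ^ ν)
    (hg : ∀ j ∈ W, 0 < g j ∧ g j ≤ γ) :
    ∀ j ∈ W, C j ^ 2 ≤ E₀ * M₁ * (Real.log (g j ^ 2)⁻¹) ^ ν := by
  intro j hj
  obtain ⟨hg0, hgle⟩ := hg j hj
  have hage : K - j ≤ N₁ := by have := (hwin j hj).2; omega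
  have h1 : Γ ^ (K - j) ≤ Γ ^ N₁ := pow_le_pow_right₀ hΓ hage
  have hy : 0 ≤ Real.log (γ ^ 2)⁻¹ := log_inv_sq_nonneg (hg0.trans_le hgle) hγ1
  have h2 : (Real.log (γ ^ 2)⁻¹) ^ ν ≤ (Real.log (g j ^ 2)⁻¹) ^ ν :=
    pow_le_pow_left₀ hy (log_inv_sq_mono hg0 hgle) ν
  calc C j ^ 2 ≤ E₀ * Γ ^ (K - j) := henv j hj
    _ ≤ E₀ * Γ ^ N₁ := mul_le_mul_of_nonneg_left h1 hE₀
    _ ≤ E₀ * (M₁ * (Real.log (γ ^ 2)⁻¹) ^ ν) := mul_le_mul_of_nonneg_left hdepth hE₀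
    _ ≤ E₀ * (M₁ * (Real.log (g j ^ 2)⁻¹) ^ ν) :=
        mul_le_mul_of_nonneg_left (mul_le_mul_of_nonneg_left h2 hM₁) hE₀
    _ = E₀ * M₁ * (Real.log (g j ^ 2)⁻¹) ^ ν := by ring

/-- The bridge from the log-log form of a floor-type depth: `N₁ ≤ N₀ + ν · log y / log Γ` with `1 < Γ`, `1 ≤ y` gives
`Γ^{N₁} ≤ Γ^{N₀} · y^ν` (with `y = log (γ²)⁻¹` and `Γ = L^m`: B16 p.363's ‹N ≥ (ν/log L) log log g_k⁻²› taken at the floor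
up to `N₀` is the hypothesis `hdepth` of `polylogEnvelope_of_floorDepth` with `M₁ = Γ^{N₀}`). [folklore] -/
theorem pow_le_of_le_loglog {Γ y : ℝ} {N₁ N₀ ν : ℕ} (hΓ : 1 < Γ) (hy : 1 ≤ y)
    (h : (N₁ : ℝ) ≤ N₀ + ν * Real.log y / Real.log Γ) : Γ ^ N₁ ≤ Γ ^ N₀ * y ^ ν := by
  have hΓ0 : 0 < Γ := by linarith
  have hlΓ : 0 < Real.log Γ := Real.log_pos hΓ
  have hy0 : 0 < y := by linarith
  have h' : (N₁ : ℝ) * Real.log Γ ≤ N₀ * Real.log Γ + ν * Real.log y := by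
    have := mul_le_mul_of_nonneg_right h hlΓ.le
    rwa [add_mul, div_mul_cancel₀ _ hlΓ.ne'] at this
  calc Γ ^ N₁ = Real.exp (N₁ * Real.log Γ) := by rw [Real.exp_nat_mul, Real.exp_log hΓ0]
    _ ≤ Real.exp (N₀ * Real.log Γ + ν * Real.log y) := Real.exp_le_exp.2 h'
    _ = Γ ^ N₀ * y ^ ν := by
        rw [Real.exp_add, Real.exp_nat_mul, Real.exp_nat_mul, Real.exp_log hΓ0, Real.exp_log hy0]

/-- **BRANCH (B) ⇒ (A): FLOOR-TYPE DEPTH ⇒ (PL) IS A SMALL-COUPLING CLAUSE.**  Age-geometric envelope + floor-type depth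
+ couplings in `(0, γ]` with `γ ≤ g₀ ≤ 1`, `g₀` the §1 threshold for `M = E₀M₁A₀`, `n = ν + p₀`, `c = κs/2`, + widths
`≤ 1/2` ⇒ (PL) on the window. [folklore] -/
theorem smPlacement_of_floorDepth {W : Set ℕ} {C ρ g : ℕ → ℝ} {A₀ E₀ M₁ Γ γ g₀ κ s : ℝ} {K N₁ ν p₀ : ℕ}
    (hA₀ : 0 ≤ A₀) (hΓ : 1 ≤ Γ) (hE₀ : 0 ≤ E₀) (hM₁ : 0 ≤ M₁) (hg₀ : g₀ ≤ 1) (hγ : γ ≤ g₀)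
    (hthr : ∀ x, 0 < x → x ≤ g₀ → E₀ * M₁ * A₀ * (x * (Real.log (x ^ 2)⁻¹) ^ (ν + p₀)) ≤ κ * s / 2)
    (hwin : ∀ j ∈ W, j ≤ K ∧ K ≤ j + N₁)
    (henv : ∀ j ∈ W, C j ^ 2 ≤ E₀ * Γ ^ (K - j))
    (hdepth : Γ ^ N₁ ≤ M₁ * (Real.log (γ ^ 2)⁻¹) ^ ν)
    (hg : ∀ j ∈ W, 0 < g j ∧ g j ≤ γ)
    (hρ : ∀ j ∈ W, ρ j ≤ 1 / 2) (hκs : 0 ≤ κ * s) :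
    SMPlacement W C ρ g A₀ κ s p₀ :=
  smPlacement_of_polylogEnvelope (E₀ := E₀ * M₁) (q := ν) hA₀ hg₀ hthr
    (fun j hj => ⟨(hg j hj).1, (hg j hj).2.trans hγ⟩)
    (polylogEnvelope_of_floorDepth hΓ hE₀ hM₁ (hγ.trans hg₀) hwin henv hdepth hg) hρ hκs

/-- **BRANCH (C): CAP-TYPE DEPTH FORCES A FLOOR UNDER THE PLACEMENT QUANTITY.**  If the window depth is of CAP TYPE,
`(log (γ²)⁻¹)^r ≤ N₁` with `1 ≤ r` (the shape of B14 (2.5) `R_j ≥ (log g_j⁻²)^r` = tree `B14.IsRj`, cf.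
`capDepth_of_isRj`; B16 p.384 ‹with N = R_j›), the reach coefficient at the oldest live level `j₀` is bounded BELOW
geometrically in the depth, `c · Γ^{N₁} ≤ C_{j₀}²` with `e ≤ Γ`, and the coupling there is comparable to `γ`
(`lam·γ ≤ g_{j₀} ≤ γ`, `0 < lam`) with `1 ≤ log (γ²)⁻¹` (i.e. `γ ≤ e^{−1/2}`), then `c · lam · A₀ / γ ≤ C_{j₀}² · ε(g_{j₀})` —
the placement quantity is at least of order `γ⁻¹`, because `Γ^{N₁} ≥ e^{N₁} ≥ e^{log γ⁻²} = γ⁻²` beats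
`ε(g_{j₀}) ≥ A₀ · lam · γ`. [folklore] -/
theorem floor_of_capDepth {C g : ℕ → ℝ} {A₀ c lam Γ γ : ℝ} {p₀ r N₁ j₀ : ℕ}
    (hA₀ : 0 ≤ A₀) (hc : 0 ≤ c) (hlam : 0 < lam) (hγ0 : 0 < γ) (hγe : 1 ≤ Real.log (γ ^ 2)⁻¹)
    (hr : 1 ≤ r) (hcap : (Real.log (γ ^ 2)⁻¹) ^ r ≤ (N₁ : ℝ)) (hΓ : Real.exp 1 ≤ Γ)
    (henv : c * Γ ^ N₁ ≤ C j₀ ^ 2) (hgj : lam * γ ≤ g j₀) (hgj' : g j₀ ≤ γ) :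
    c * lam * A₀ / γ ≤ C j₀ ^ 2 * (g j₀ * p0Profile A₀ p₀ (g j₀)) := by
  have hgpos : 0 < g j₀ := (mul_pos hlam hγ0).trans_le hgj
  have hγne : γ ≠ 0 := hγ0.ne'
  have hyN : Real.log (γ ^ 2)⁻¹ ≤ N₁ := (le_self_pow₀ hγe (by omega : r ≠ 0)).trans hcap
  have hΓN : (γ ^ 2)⁻¹ ≤ Γ ^ N₁ := by
    calc (γ ^ 2)⁻¹ = Real.exp (Real.log (γ ^ 2)⁻¹) := by rw [Real.exp_log (inv_pos.2 (pow_pos hγ0 2))]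
      _ ≤ Real.exp (N₁ : ℝ) := Real.exp_le_exp.2 hyN
      _ = Real.exp 1 ^ N₁ := by rw [← Real.exp_nat_mul, mul_one]
      _ ≤ Γ ^ N₁ := pow_le_pow_left₀ (Real.exp_pos 1).le hΓ N₁
  have hε : A₀ * (lam * γ) ≤ g j₀ * p0Profile A₀ p₀ (g j₀) :=
    (mul_le_mul_of_nonneg_left hgj hA₀).trans
      (mul_le_mul_p0Profile hA₀ hgpos.le (one_le_log_inv_sq_of_le hgpos hgj' hγe) p₀)
  have hCsq : c * (γ ^ 2)⁻¹ ≤ C j₀ ^ 2 := (mul_le_mul_of_nonneg_left hΓN hc).trans henv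
  calc c * lam * A₀ / γ = (c * (γ ^ 2)⁻¹) * (A₀ * (lam * γ)) := by field_simp
    _ ≤ C j₀ ^ 2 * (g j₀ * p0Profile A₀ p₀ (g j₀)) := mul_le_mul hCsq hε (by positivity) (sq_nonneg _)

/-- **BRANCH (C): (PL) FAILS THROUGHOUT THE SMALL-COUPLING REGIME.**  Under the hypotheses of `floor_of_capDepth` at a
level `j₀` of the window, with `0 ≤ ρ j₀`, `0 ≤ κ`, `0 ≤ s`: for EVERY `γ` with `γ · κs < c · lam · A₀` the placement
(PL) is false — a cap-type window with an age-geometric reach cannot place (SM) for small couplings. [folklore] -/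
theorem not_smPlacement_of_capDepth {W : Set ℕ} {C ρ g : ℕ → ℝ} {A₀ c lam Γ γ κ s : ℝ} {p₀ r N₁ j₀ : ℕ}
    (hA₀ : 0 ≤ A₀) (hc : 0 ≤ c) (hlam : 0 < lam) (hγ0 : 0 < γ) (hγe : 1 ≤ Real.log (γ ^ 2)⁻¹)
    (hr : 1 ≤ r) (hcap : (Real.log (γ ^ 2)⁻¹) ^ r ≤ (N₁ : ℝ)) (hΓ : Real.exp 1 ≤ Γ)
    (henv : c * Γ ^ N₁ ≤ C j₀ ^ 2) (hgj : lam * γ ≤ g j₀) (hgj' : g j₀ ≤ γ)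
    (hj₀ : j₀ ∈ W) (hρ : 0 ≤ ρ j₀) (hκ : 0 ≤ κ) (hs : 0 ≤ s)
    (hsmall : γ * (κ * s) < c * lam * A₀) :
    ¬ SMPlacement W C ρ g A₀ κ s p₀ := by
  intro h
  have h1 := h j₀ hj₀
  have h2 := floor_of_capDepth (p₀ := p₀) hA₀ hc hlam hγ0 hγe hr hcap hΓ henv hgj hgj'
  have h3 : κ * (s * (1 - ρ j₀)) ≤ κ * s := by nlinarith [mul_nonneg (mul_nonneg hκ hs) hρ]
  have h4 : κ * s < c * lam * A₀ / γ := by rw [lt_div_iff₀ hγ0]; linarith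
  linarith

/-- The cap-type depth hypothesis FROM THE TREE's (2.5): `B14.IsRj L r γ N₁` («R_j is the smallest number of the form Lʳ
such, that R_j ≥ (log g_j⁻²)ʳ», B14 p.255, for the coupling `γ = g_j` and `N₁ = R_j` — B16 p.384 ‹with N = R_j›) gives
`(log (γ²)⁻¹)^r ≤ N₁` (its second conjunct, by name; the minimality conjunct is not used). [folklore] -/
theorem capDepth_of_isRj {L r N₁ : ℕ} {γ : ℝ} (h : B14.IsRj L r γ N₁) : (Real.log (γ ^ 2)⁻¹) ^ r ≤ (N₁ : ℝ) := by
  obtain ⟨_, _, h2, _⟩ := h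
  exact h2

/-- **BRANCH (C) WITH THE DEPTH AT PRINT's (2.5).**  `not_smPlacement_of_capDepth` with the cap hypothesis supplied by
`B14.IsRj L r γ N₁` (window depth = `R_j` of the reference coupling): (PL) fails for every `γ` with
`γ · κs < c · lam · A₀`. [folklore] -/
theorem not_smPlacement_of_isRj {W : Set ℕ} {C ρ g : ℕ → ℝ} {A₀ c lam Γ γ κ s : ℝ} {p₀ L r N₁ j₀ : ℕ}
    (hRj : B14.IsRj L r γ N₁)
    (hA₀ : 0 ≤ A₀) (hc : 0 ≤ c) (hlam : 0 < lam) (hγ0 : 0 < γ) (hγe : 1 ≤ Real.log (γ ^ 2)⁻¹)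
    (hr : 1 ≤ r) (hΓ : Real.exp 1 ≤ Γ)
    (henv : c * Γ ^ N₁ ≤ C j₀ ^ 2) (hgj : lam * γ ≤ g j₀) (hgj' : g j₀ ≤ γ)
    (hj₀ : j₀ ∈ W) (hρ : 0 ≤ ρ j₀) (hκ : 0 ≤ κ) (hs : 0 ≤ s)
    (hsmall : γ * (κ * s) < c * lam * A₀) :
    ¬ SMPlacement W C ρ g A₀ κ s p₀ :=
  not_smPlacement_of_capDepth hA₀ hc hlam hγ0 hγe hr (capDepth_of_isRj hRj) hΓ henv hgj hgj' hj₀ hρ hκ hs hsmall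

end Fork

/-! ## §4 The dictionary (SM) ↔ (PL) under the readings, as hypotheses -/

section Dictionary

/-- **(PL) ⇒ (SM) UNDER THE UPPER READINGS.**  Majorant `H ≤ h·ζ` (`0 < h`, `0 ≤ ζ`), threshold `θ = e·ζ` with the SAME
unit factor `ζ` (`0 ≤ e`), reach `0 ≤ x₀ ≤ C·e` inside half the analyticity radius `x₀ ≤ R/2` (`0 < R`), and the
placement `C²·e ≤ (R²/(72h)) · s(1 − ρ)` give the binder `(cauchyCoef H R x₀ + cauchyCoef H R x₀)·x₀² ≤ s·θ(1 − ρ)`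
(`18H/(R − x₀)² ≤ 72hζ/R²`, `x₀² ≤ C²e²`, one factor `e·ζ = θ` splits off). [folklore] -/
theorem binder_of_placement {H R x₀ s θ ρ e ζ h C : ℝ}
    (hh : 0 < h) (hR : 0 < R) (hζ : 0 ≤ ζ) (he : 0 ≤ e)
    (hH : H ≤ h * ζ) (hθ : θ = e * ζ) (hx₀0 : 0 ≤ x₀) (hx₀C : x₀ ≤ C * e) (hx₀R : x₀ ≤ R / 2)
    (hpl : C ^ 2 * e ≤ R ^ 2 / (72 * h) * (s * (1 - ρ))) :
    (cauchyCoef H R x₀ + cauchyCoef H R x₀) * x₀ ^ 2 ≤ s * (θ * (1 - ρ)) := by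
  have hRne : R ≠ 0 := hR.ne'
  have hhne : h ≠ 0 := hh.ne'
  have hRx0 : 0 < R - x₀ := by linarith
  have hden : R ^ 2 / 4 ≤ (R - x₀) ^ 2 := by nlinarith
  have hcc : cauchyCoef H R x₀ ≤ 36 * h * ζ / R ^ 2 := by
    unfold cauchyCoef
    calc 9 * H / (R - x₀) ^ 2 ≤ 9 * (h * ζ) / (R - x₀) ^ 2 :=
          div_le_div_of_nonneg_right (by nlinarith) (by positivity)
      _ ≤ 9 * (h * ζ) / (R ^ 2 / 4) := div_le_div_of_nonneg_left (by positivity) (by positivity) hden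
      _ = 36 * h * ζ / R ^ 2 := by field_simp; ring
  have hx2 : x₀ ^ 2 ≤ C ^ 2 * e ^ 2 := by
    rw [← mul_pow]; exact pow_le_pow_left₀ hx₀0 hx₀C 2
  have hCe : 0 ≤ C * e := hx₀0.trans hx₀C
  calc (cauchyCoef H R x₀ + cauchyCoef H R x₀) * x₀ ^ 2
      ≤ (36 * h * ζ / R ^ 2 + 36 * h * ζ / R ^ 2) * (C ^ 2 * e ^ 2) :=
        mul_le_mul (add_le_add hcc hcc) hx2 (sq_nonneg _) (by positivity)
    _ = (72 * h / R ^ 2 * (ζ * e)) * (C ^ 2 * e) := by ring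
    _ ≤ (72 * h / R ^ 2 * (ζ * e)) * (R ^ 2 / (72 * h) * (s * (1 - ρ))) :=
        mul_le_mul_of_nonneg_left hpl (by positivity)
    _ = s * (θ * (1 - ρ)) := by rw [hθ]; field_simp

/-- **(PL) ⇒ (SM) ON A WINDOW, IN THE MEMBER'S SYNTAX.**  `SMPlacement W C ρ g A₀ (R²/(72h)) s p₀` plus, per level
`j ∈ W`, the upper readings — `H j ≤ h · ζ j`, `0 ≤ x₀ j ≤ C j · ε(g j)`, `x₀ j ≤ R/2` — give, per level, LITERALLY the
`hSM` binder of `T4ShellMeasureAnalytic.fibreAlternative_of_analytic_family` /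
`T4ShellMeasurePlaquette.fibreAlternative_of_bondAnalytic_family_four` with majorant `H j`, reach `x₀ j` (there
`Real.exp (−r₀)`) and threshold `θ := ε(g j) · ζ j`, `ε(g j) = g j · p0Profile A₀ p₀ (g j)`. [folklore] -/
theorem hSM_of_smPlacement {W : Set ℕ} {C ρ g H ζ x₀ : ℕ → ℝ} {A₀ s R h : ℝ} {p₀ : ℕ}
    (hpl : SMPlacement W C ρ g A₀ (R ^ 2 / (72 * h)) s p₀)
    (hh : 0 < h) (hR : 0 < R) (hA₀ : 0 ≤ A₀)
    (hg : ∀ j ∈ W, 0 < g j ∧ g j ≤ 1)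
    (hζ : ∀ j ∈ W, 0 ≤ ζ j) (hH : ∀ j ∈ W, H j ≤ h * ζ j)
    (hx₀ : ∀ j ∈ W, 0 ≤ x₀ j ∧ x₀ j ≤ C j * (g j * p0Profile A₀ p₀ (g j)) ∧ x₀ j ≤ R / 2) :
    ∀ j ∈ W, (cauchyCoef (H j) R (x₀ j) + cauchyCoef (H j) R (x₀ j)) * x₀ j ^ 2 ≤
      s * (g j * p0Profile A₀ p₀ (g j) * ζ j * (1 - ρ j)) := by
  intro j hj
  obtain ⟨hx0, hxC, hxR⟩ := hx₀ j hj
  exact binder_of_placement hh hR (hζ j hj) (mul_p0Profile_nonneg hA₀ (hg j hj).1 (hg j hj).2 p₀) (hH j hj) rfl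
    hx0 hxC hxR (hpl j hj)

/-- **(SM) ⇒ (PL′) UNDER THE LOWER READINGS.**  Conversely, if the majorant is at least `h′·ζ` (`0 < h′`, `0 < ζ`),
the threshold is `θ = e·ζ` (`0 < e`), and the class REACHES `C′·e ≤ x₀` (`0 ≤ C′`, `0 ≤ x₀ < R`) — the reach of the
fibre family is forced by the good class, not chosen —, then the binder (SM) implies the placement
`C′²·e ≤ (R²/(18h′)) · s(1 − ρ)`.  So §3's fork on (PL) is a fork on (SM). [folklore] -/
theorem placement_of_binder {H R x₀ s θ ρ e ζ h' C' : ℝ}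
    (hR : 0 < R) (hh' : 0 < h') (hζ : 0 < ζ) (he : 0 < e)
    (hH : h' * ζ ≤ H) (hθ : θ = e * ζ) (hx₀0 : 0 ≤ x₀) (hx₀ : C' * e ≤ x₀) (hC' : 0 ≤ C') (hx₀R : x₀ < R)
    (hSM : (cauchyCoef H R x₀ + cauchyCoef H R x₀) * x₀ ^ 2 ≤ s * (θ * (1 - ρ))) :
    C' ^ 2 * e ≤ R ^ 2 / (18 * h') * (s * (1 - ρ)) := by
  have hRne : R ≠ 0 := hR.ne'
  have hhne : h' ≠ 0 := hh'.ne'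
  have hζne : ζ ≠ 0 := hζ.ne'
  have hene : e ≠ 0 := he.ne'
  have hRx0 : 0 < R - x₀ := by linarith
  have hden : (R - x₀) ^ 2 ≤ R ^ 2 := by nlinarith
  have hHpos : 0 ≤ H := le_trans (by positivity) hH
  have hcc : 18 * h' * ζ / R ^ 2 ≤ cauchyCoef H R x₀ + cauchyCoef H R x₀ := by
    unfold cauchyCoef
    calc 18 * h' * ζ / R ^ 2 = 2 * (9 * (h' * ζ) / R ^ 2) := by ring
      _ ≤ 2 * (9 * (h' * ζ) / (R - x₀) ^ 2) :=
          mul_le_mul_of_nonneg_left (div_le_div_of_nonneg_left (by positivity) (by positivity) hden) (by norm_num)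
      _ ≤ 2 * (9 * H / (R - x₀) ^ 2) :=
          mul_le_mul_of_nonneg_left (div_le_div_of_nonneg_right (by nlinarith) (by positivity)) (by norm_num)
      _ = 9 * H / (R - x₀) ^ 2 + 9 * H / (R - x₀) ^ 2 := by ring
  have hx2 : C' ^ 2 * e ^ 2 ≤ x₀ ^ 2 := by
    rw [← mul_pow]; exact pow_le_pow_left₀ (by positivity) hx₀ 2
  have hsum0 : 0 ≤ cauchyCoef H R x₀ + cauchyCoef H R x₀ := by
    have := cauchyCoef_nonneg (R := R) (x₀ := x₀) hHpos; linarith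
  have key : (18 * h' * ζ / R ^ 2) * (C' ^ 2 * e ^ 2) ≤ s * (e * ζ * (1 - ρ)) := by
    calc (18 * h' * ζ / R ^ 2) * (C' ^ 2 * e ^ 2)
        ≤ (cauchyCoef H R x₀ + cauchyCoef H R x₀) * x₀ ^ 2 := mul_le_mul hcc hx2 (by positivity) hsum0
      _ ≤ s * (e * ζ * (1 - ρ)) := by rw [hθ] at hSM; exact hSM
  calc C' ^ 2 * e = (R ^ 2 / (18 * h' * ζ * e)) * ((18 * h' * ζ / R ^ 2) * (C' ^ 2 * e ^ 2)) := by
        field_simp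
    _ ≤ (R ^ 2 / (18 * h' * ζ * e)) * (s * (e * ζ * (1 - ρ))) := mul_le_mul_of_nonneg_left key (by positivity)
    _ = R ^ 2 / (18 * h') * (s * (1 - ρ)) := by field_simp

/-- **BRANCH (C) AT THE BINDER.**  Cap-type depth, age-geometric reach FROM BELOW at the oldest live level `j₀`
(`c · Γ^{N₁} ≤ C′_{j₀}²`), comparability, and the LOWER readings at `j₀` (`h′·ζ ≤ H`, `θ = ε(g_{j₀})·ζ`,
`C′_{j₀}·ε(g_{j₀}) ≤ x₀ < R`, `0 < A₀`): for every `γ` with `γ · (R²/(18h′)) · s < c · lam · A₀` the binder (SM) of member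
(γ″) at level `j₀` is FALSE. [folklore] -/
theorem not_binder_of_capDepth {C' g : ℕ → ℝ} {A₀ c lam Γ γ s H R x₀ θ ρ ζ h' : ℝ} {p₀ r N₁ j₀ : ℕ}
    (hA₀ : 0 < A₀) (hc : 0 ≤ c) (hlam : 0 < lam) (hγ0 : 0 < γ) (hγe : 1 ≤ Real.log (γ ^ 2)⁻¹)
    (hr : 1 ≤ r) (hcap : (Real.log (γ ^ 2)⁻¹) ^ r ≤ (N₁ : ℝ)) (hΓ : Real.exp 1 ≤ Γ)
    (henv : c * Γ ^ N₁ ≤ C' j₀ ^ 2) (hgj : lam * γ ≤ g j₀) (hgj' : g j₀ ≤ γ)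
    (hR : 0 < R) (hh' : 0 < h') (hζ : 0 < ζ) (hH : h' * ζ ≤ H)
    (hθ : θ = g j₀ * p0Profile A₀ p₀ (g j₀) * ζ)
    (hx₀0 : 0 ≤ x₀) (hx₀ : C' j₀ * (g j₀ * p0Profile A₀ p₀ (g j₀)) ≤ x₀) (hC' : 0 ≤ C' j₀) (hx₀R : x₀ < R)
    (hρ : 0 ≤ ρ) (hs : 0 ≤ s) (hsmall : γ * (R ^ 2 / (18 * h') * s) < c * lam * A₀) :
    ¬ ((cauchyCoef H R x₀ + cauchyCoef H R x₀) * x₀ ^ 2 ≤ s * (θ * (1 - ρ))) := by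
  intro hSM
  have hgpos : 0 < g j₀ := (mul_pos hlam hγ0).trans_le hgj
  have hlog : 1 ≤ Real.log (g j₀ ^ 2)⁻¹ := one_le_log_inv_sq_of_le hgpos hgj' hγe
  have he : 0 < g j₀ * p0Profile A₀ p₀ (g j₀) :=
    lt_of_lt_of_le (by positivity) (mul_le_mul_p0Profile hA₀.le hgpos.le hlog p₀)
  have hpl := placement_of_binder hR hh' hζ he hH hθ hx₀0 hx₀ hC' hx₀R hSM
  have hfl := floor_of_capDepth (p₀ := p₀) hA₀.le hc hlam hγ0 hγe hr hcap hΓ henv hgj hgj'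
  have hκ : 0 ≤ R ^ 2 / (18 * h') := by positivity
  have h3 : R ^ 2 / (18 * h') * (s * (1 - ρ)) ≤ R ^ 2 / (18 * h') * s := by
    nlinarith [mul_nonneg (mul_nonneg hκ hs) hρ]
  have h4 : R ^ 2 / (18 * h') * s < c * lam * A₀ / γ := by rw [lt_div_iff₀ hγ0]; linarith
  linarith

end Dictionary

/-! ## §5 Non-vacuity on explicit numbers (kernel-checked, honest scope: toys, not instantiations) -/

section Toys

/-- `1 ≤ log ((1/2)²)⁻¹ = log 4` (since `e < 3 < 4`). [folklore] -/
theorem one_le_log_four : 1 ≤ Real.log (((1 : ℝ) / 2) ^ 2)⁻¹ := by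
  have h4 : (((1 : ℝ) / 2) ^ 2)⁻¹ = 4 := by norm_num
  rw [h4, ← Real.log_exp 1]
  exact Real.log_le_log (Real.exp_pos 1) (by linarith [Real.exp_one_lt_three])

/-- `log ((1/2)²)⁻¹ = log 4 ≤ 2` (since `4 ≤ 1 + 2 + 2²/2 ≤ e²`). [folklore] -/
theorem log_four_le_two : Real.log (((1 : ℝ) / 2) ^ 2)⁻¹ ≤ 2 := by
  have h4 : (((1 : ℝ) / 2) ^ 2)⁻¹ = 4 := by norm_num
  rw [h4, Real.log_le_iff_le_exp (by norm_num)]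
  nlinarith [Real.quadratic_le_exp_of_nonneg (by norm_num : (0 : ℝ) ≤ 2)]

/-- CAP-TYPE TOY: window coupling `γ = g_{j₀} = 1/2`, depth `N₁ = 2 ≥ (log 4)¹`, `Γ = 3 ≥ e`, reach floor
`1 · 3² ≤ 3²`, `A₀ = 1`, `p₀ = 0`, `κ = s = 1`: `γ·κs = 1/2 < 1 = c·lam·A₀`, so (PL) fails — the hypotheses of
`not_smPlacement_of_capDepth` are jointly satisfiable and the negation fires. [folklore] -/
example : ¬ SMPlacement {0} (fun _ => 3) (fun _ => 0) (fun _ => 1 / 2) 1 1 1 0 :=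
  not_smPlacement_of_capDepth (c := 1) (lam := 1) (Γ := 3) (γ := 1 / 2) (r := 1) (N₁ := 2) (j₀ := 0)
    zero_le_one zero_le_one one_pos (by norm_num) one_le_log_four le_rfl
    (by rw [pow_one]; exact_mod_cast log_four_le_two) Real.exp_one_lt_three.le
    (by norm_num) (by norm_num) (by norm_num) (Set.mem_singleton 0) le_rfl zero_le_one zero_le_one (by norm_num)

/-- FLOOR-TYPE TOY: a one-level window `{K}` (depth `N₁ = 0`, `Γ = 3`, `M₁ = 1`, `ν = 0`: `3⁰ ≤ 1 · (log (γ²)⁻¹)⁰`),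
constant reach `C K² ≤ E₀ · 3⁰`: the composite `smPlacement_of_floorDepth` fires from the §1 threshold. [folklore] -/
example {A₀ E₀ κ s : ℝ} (hA₀ : 0 ≤ A₀) (hE₀ : 0 ≤ E₀) (hκs : 0 < κ * s) (K p₀ : ℕ) (C ρ : ℕ → ℝ)
    (hC : C K ^ 2 ≤ E₀) (hρ : ρ K ≤ 1 / 2) :
    ∃ g₀ : ℝ, 0 < g₀ ∧ ∀ g : ℕ → ℝ, (0 < g K ∧ g K ≤ g₀) → SMPlacement {K} C ρ g A₀ κ s p₀ := by
  obtain ⟨g₀, hg₀, hg₀1, hthr⟩ := exists_threshold_logInvSq_pow (E₀ * 1 * A₀) (κ * s / 2) (by linarith) (0 + p₀)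
  refine ⟨g₀, hg₀, fun g hg => ?_⟩
  refine smPlacement_of_floorDepth (Γ := 3) (M₁ := 1) (γ := g₀) (K := K) (N₁ := 0) (ν := 0)
    hA₀ (by norm_num) hE₀ zero_le_one (hg₀1.trans (by norm_num)) le_rfl hthr ?_ ?_ (by simp) ?_ ?_ hκs.le
  · intro j hj; rw [Set.mem_singleton_iff.1 hj]; exact ⟨le_rfl, by omega⟩
  · intro j hj; rw [Set.mem_singleton_iff.1 hj]; simpa using hC
  · intro j hj; rw [Set.mem_singleton_iff.1 hj]; exact hg
  · intro j hj; rw [Set.mem_singleton_iff.1 hj]; exact hρ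

end Toys

end Literature.MathematicalPhysics.QuantumFieldTheory.Balaban1983to89.T4ShellMeasureSMPlacement
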